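import Mathlib
import Literature.NumberTheory.LFunctions.Zhang2022.Section14MeanSquareMajorant
import Literature.NumberTheory.Sieve.DivisorBound

/-!
# Toolkit: the generalized divisor functions `τ_j` — submultiplicativity, monotonicity, the divisor bound, summability of `Σ τ_j(n)n^{−σ}`, and `Σ_{n≤Y} τ_j(n)/n ≤ (1 + log Y)^j`

Topic `Literature/NumberTheory/LFunctions/Zhang2022` (ZHANG-L discharge lane, LIB-PLAN v0 item **D2**). Everything in this
file is PROVED (theorems only, no definitions). It makes PUBLIC, once, the elementary toolkit about the tree's real
arithmetic functions `MeanSquareMajorant.tau j = ζ^j` (`Zhang2022/Section14MeanSquareMajorant.lean`) that the Zhang (2022)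
audit tree so far re-proved privately file by file (`Section7cLPolyLargeSieve` :51, `Section7ExtendedRangeLS` :53,
`Section7ExtendedRangeTail` :63, `Section7SmallRAggregation` :69 — `tau_mul_le`; `Section16Eq164Mellin` :225 —
`tau_two_le_tau_three`; `Section7cProofs` :66 and three more — `one_le_tau`; `TypedSection15AIdentities` :1140/:1182 —
`summable_tau_three_(mul_)div_rpow`):

* `tau_mul_le` — `τ_j(mn) ≤ τ_j(m)τ_j(n)` for all `m, n` (submultiplicativity);
* `tau_le_tau_succ`, `tau_le_tau_of_le`, `tau_two_le_tau_three` — `τ_j(n) ≤ τ_k(n)` for `j ≤ k`;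
* `tau_succ_dvd_le`, `tau_dvd_le` — `d ∣ n ≠ 0 ⇒ τ_j(d) ≤ τ_j(n)` (`j ≥ 1`);
* `one_le_tau_succ`, `one_le_tau` — `τ_j(n) ≥ 1` for `n, j ≥ 1`;
* `exists_tau_le_mul_rpow` — the divisor bound `τ_j(n) ≤ C_{j,ε} n^ε` (from the tree's Hardy–Wright Thm 315,
  `Literature.NumberTheory.Sieve.exists_card_divisors_le_mul_rpow'`, by induction on `j`);
* `summable_tau_div_rpow`, `summable_tau_mul_rpow_neg`, `summable_tau_mul_div_rpow` — `Σ_n τ_j(n)n^{−σ} < ∞` and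
  `Σ_l τ_j(al)l^{−σ} < ∞` for `σ > 1`, `a ≥ 1`;
* `sum_tau_add_div_Icc_le` — `Σ_{n≤Y} τ_{j₁+j₂}(n)/n ≤ (Σ_{n≤Y} τ_{j₁}(n)/n)(Σ_{n≤Y} τ_{j₂}(n)/n)` (the antidiagonals of
  `1 ≤ n ≤ Y` are disjoint and sit in the box `[1,Y]²`, as in `Section3SigmaSplitting.sum_card_divisors_pow_succ_div_le_sq`);
* `sum_tau_div_Icc_le_log_pow` — `Σ_{1≤n≤Y} τ_j(n)/n ≤ (1 + log Y)^j` (constant `1`; Mathlib's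
  `harmonic_le_one_add_log`), with the real-cutoff form `sum_tau_div_Icc_floor_le_log_pow` and the shifted form
  `sum_tau_mul_div_Icc_le` (`Σ_{n≤Y} τ_j(an)/n ≤ τ_j(a)(1 + log Y)^j`).

Consumers (LIB-PLAN §2 D2): every "terms with `(l,m) > 1` contribute `≪ D^{−c}`" tail and Rankin step of Zhang 2022
§§12, 15, 16, 17 and the coefficient-generic §7 b-error chain behind (14.6)/(14.8). This file asserts nothing about
the manuscript's claims. Deliberately NOT here: the mean-square counts `Σ τ_j(n)²/n` (already
`MeanSquareMajorant.sum_tau_sq_div_le`) and the convolution majorants (`MeanSquareMajorant.norm_seqConv_le_tau`).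

## References

* A. Ivić, *The Riemann Zeta-Function*, Wiley 1985, §1.6: (1.68) `ζ^k(s) = Σ d_k(n)n^{−s}` (`σ > 1`), (1.70)
  `d_k(n) < exp(C(k) log n/log log n)`, and the recursion `d_k(n) = Σ_{δ∣n} d_{k−1}(δ)` (p. 31).
  [cite: Ivic1985, §1.6 (1.68)–(1.70), pp. 30–31]
* H. Iwaniec, E. Kowalski, *Analytic Number Theory*, AMS 2004, §1.6: (1.80) `Σ_{n≤x} τ_k(n)^ℓ ≪ x(log x)^{k^ℓ−1}`,
  (1.81) `τ_k(n) ≪ n^ε`. [cite: IwaniecKowalski2004, §1.6 (1.80)–(1.81)]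
* O. Bordellès, *Arithmetic Tales. Advanced Edition*, Springer 2020, Ch. 4 Exercise 89 (a) and its printed solution
  (`τ_k` completely sub-multiplicative: `τ_k(mn) ≤ τ_k(m)τ_k(n)`). [cite: Bordelles2020ArithmeticTales, Ch. 4 Ex. 89]
* G. H. Hardy, E. M. Wright, *An Introduction to the Theory of Numbers*, 6th ed., OUP 2008, Thm 315 (`d(n) ≪ n^ε`)
  — the kernel input, through `Literature.NumberTheory.Sieve.DivisorBound`. [cite: HardyWright2008, Theorem 315]
* Y. Zhang, *Discrete mean estimates and the Landau–Siegel zero*, arXiv:2211.02515v1 (2022), (7.5), (14.1), (15.2)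
  (where the majorants `τ_k` are consumed). [cite: Zhang2022LandauSiegel, §7 (7.5) p. 34]
-/

noncomputable section

open Finset Real ArithmeticFunction

namespace Literature.NumberTheory.LFunctions.Zhang2022.MeanSquareMajorant

/-! ### Submultiplicativity and monotonicity -/

/-- **`τ_j(mn) ≤ τ_j(m)τ_j(n)`** for all `m, n, j` (every divisor of `mn` is a product of a divisor of `m` and a
divisor of `n`; induction on `j`) — "`τ_k` is completely sub-multiplicative", the first inequality of the printed
solution. [cite: Bordelles2020ArithmeticTales, Ch. 4, Exercise 89 (a) and its solution] -/
theorem tau_mul_le (j m n : ℕ) : tau j (m * n) ≤ tau j m * tau j n := by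
  induction j generalizing m n with
  | zero =>
    simp only [tau_zero, ArithmeticFunction.one_apply, mul_eq_one]
    by_cases hm : m = 1
    · by_cases hn : n = 1
      · simp [hm, hn]
      · simp [hm, hn]
    · simp [hm]
  | succ j ih =>
    rcases Nat.eq_zero_or_pos m with rfl | hm
    · simp only [zero_mul, ArithmeticFunction.map_zero]
      exact le_of_eq (by ring)
    rcases Nat.eq_zero_or_pos n with rfl | hn
    · simp only [mul_zero, ArithmeticFunction.map_zero]
      exact le_of_eq (by ring)
    rw [tau_succ_apply, tau_succ_apply, tau_succ_apply, Finset.sum_mul_sum, ← Finset.sum_product']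
    have hsub : (m * n).divisors ⊆ (m.divisors ×ˢ n.divisors).image (fun x => x.1 * x.2) := by
      intro e he
      have hd := Nat.dvd_of_mem_divisors he
      obtain ⟨e₁, e₂, h₁, h₂, rfl⟩ := Nat.dvd_mul.mp hd
      exact Finset.mem_image.mpr ⟨(e₁, e₂), Finset.mem_product.mpr
        ⟨Nat.mem_divisors.mpr ⟨h₁, hm.ne'⟩, Nat.mem_divisors.mpr ⟨h₂, hn.ne'⟩⟩, rfl⟩
    calc ∑ e ∈ (m * n).divisors, tau j e
        ≤ ∑ e ∈ (m.divisors ×ˢ n.divisors).image (fun x => x.1 * x.2), tau j e :=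
          Finset.sum_le_sum_of_subset_of_nonneg hsub fun _ _ _ => tau_nonneg _ _
      _ ≤ ∑ x ∈ m.divisors ×ˢ n.divisors, tau j (x.1 * x.2) :=
          Finset.sum_image_le_of_nonneg fun _ _ => tau_nonneg _ _
      _ ≤ ∑ x ∈ m.divisors ×ˢ n.divisors, tau j x.1 * tau j x.2 :=
          Finset.sum_le_sum fun x _ => ih x.1 x.2

/-- **`τ_j(n) ≤ τ_{j+1}(n)`** (`τ_{j+1}(n) = Σ_{d∣n} τ_j(d)` contains the term `d = n`; both sides vanish at `n = 0`;
immediate from the printed recursion `d_k(n) = Σ_{δ∣n} d_{k−1}(δ)`). [cite: Ivic1985, §1.6, p. 31 (recursion for d_k)] -/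
theorem tau_le_tau_succ (j n : ℕ) : tau j n ≤ tau (j + 1) n := by
  rcases Nat.eq_zero_or_pos n with rfl | hn
  · simp
  · rw [tau_succ_apply j n]
    exact Finset.single_le_sum (fun d _ => tau_nonneg j d) (Nat.mem_divisors_self n hn.ne')

/-- **`τ_j(n) ≤ τ_k(n)` for `j ≤ k`** (iterate the recursion `d_k(n) = Σ_{δ∣n} d_{k−1}(δ)`).
[cite: Ivic1985, §1.6, p. 31 (recursion for d_k)] -/
theorem tau_le_tau_of_le {j k : ℕ} (h : j ≤ k) (n : ℕ) : tau j n ≤ tau k n := by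
  induction k, h using Nat.le_induction with
  | base => exact le_rfl
  | succ k _ ih => exact ih.trans (tau_le_tau_succ k n)

/-- `τ₂(n) ≤ τ₃(n)` (the instance used by the (15.8)/(16.4) machinery of the Zhang audit tree).
[cite: Ivic1985, §1.6, p. 31 (recursion for d_k)] -/
theorem tau_two_le_tau_three (n : ℕ) : tau 2 n ≤ tau 3 n := tau_le_tau_succ 2 n

/-- **`τ_{j+1}` is monotone along divisibility**: `d ∣ n`, `n ≠ 0` ⇒ `τ_{j+1}(d) ≤ τ_{j+1}(n)` (the divisors of `d`
are divisors of `n`, in the printed recursion `d_k(n) = Σ_{δ∣n} d_{k−1}(δ)`). False for `τ₀ = δ₁` (`d = 1 ∣ n = 2`), whence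
the successor. [cite: Ivic1985, §1.6, p. 31 (recursion for d_k)] -/
theorem tau_succ_dvd_le (j : ℕ) {d n : ℕ} (hdn : d ∣ n) (hn : n ≠ 0) : tau (j + 1) d ≤ tau (j + 1) n := by
  rw [tau_succ_apply, tau_succ_apply]
  exact Finset.sum_le_sum_of_subset_of_nonneg (Nat.divisors_subset_of_dvd hn hdn) fun _ _ _ => tau_nonneg _ _

/-- **`τ_j(d) ≤ τ_j(n)` for `d ∣ n ≠ 0` and `j ≥ 1`.** [cite: Ivic1985, §1.6, p. 31 (recursion for d_k)] -/
theorem tau_dvd_le {j : ℕ} (hj : 1 ≤ j) {d n : ℕ} (hdn : d ∣ n) (hn : n ≠ 0) : tau j d ≤ tau j n := by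
  obtain ⟨j, rfl⟩ := Nat.exists_eq_add_of_le' hj
  exact tau_succ_dvd_le j hdn hn

/-- **`1 ≤ τ_{j+1}(n)` for `n ≥ 1`** (there is at least the trivial factorisation; `d_1 = 𝟙` and the recursion).
[cite: Ivic1985, §1.6, p. 31 (recursion for d_k)] -/
theorem one_le_tau_succ (j : ℕ) {n : ℕ} (hn : n ≠ 0) : 1 ≤ tau (j + 1) n := by
  induction j with
  | zero => rw [tau_one_apply hn]
  | succ j ih => exact ih.trans (tau_le_tau_succ (j + 1) n)

/-- **`1 ≤ τ_j(n)` for `n, j ≥ 1`.** [cite: Ivic1985, §1.6, p. 31 (recursion for d_k)] -/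
theorem one_le_tau {j : ℕ} (hj : 1 ≤ j) {n : ℕ} (hn : n ≠ 0) : 1 ≤ tau j n := by
  obtain ⟨j, rfl⟩ := Nat.exists_eq_add_of_le' hj
  exact one_le_tau_succ j hn

/-- `τ_j(n) ≤ τ_j(n)²` for `n, j ≥ 1` (so first moments are dominated by the tree's second-moment counts
`MeanSquareMajorant.sum_tau_sq_div_le`). [cite: Ivic1985, §1.6, p. 31 (recursion for d_k)] -/
theorem tau_le_tau_sq {j : ℕ} (hj : 1 ≤ j) {n : ℕ} (hn : n ≠ 0) : tau j n ≤ tau j n ^ 2 := by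
  rw [sq]
  exact le_mul_of_one_le_left (tau_nonneg j n) (one_le_tau hj hn)

/-! ### The divisor bound `τ_j(n) ≪_{j,ε} n^ε` and summability of `Σ τ_j(n) n^{−σ}`, `σ > 1` -/

/-- **The divisor bound for `τ_j`**: for every `j` and `ε > 0` there is `C ≥ 1` with `τ_j(n) ≤ C·n^ε` for ALL `n`
(at `n = 0` both sides vanish). Induction on `j` from Hardy–Wright's `d(n) ≤ C_ε n^ε`
(`Literature.NumberTheory.Sieve.exists_card_divisors_le_mul_rpow'`): `τ_{j+1}(n) = Σ_{d∣n} τ_j(d) ≤ d(n)·C n^{ε/2}` —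
the printed route of Ivić (1.70) (which is the stronger `d_k(n) < exp(C(k) log n/log log n)`); as printed in
Iwaniec–Kowalski: "`τ_k(n) ≪ n^ε`, the implied constant depending on `ε, k`".
[cite: IwaniecKowalski2004, §1.6 (1.81)] [cite: Ivic1985, §1.6 (1.70), p. 31] -/
theorem exists_tau_le_mul_rpow (j : ℕ) {ε : ℝ} (hε : 0 < ε) :
    ∃ C : ℝ, 1 ≤ C ∧ ∀ n : ℕ, tau j n ≤ C * (n : ℝ) ^ ε := by
  induction j generalizing ε with
  | zero =>
    refine ⟨1, le_rfl, fun n => ?_⟩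
    rcases Nat.eq_zero_or_pos n with rfl | hn
    · simp [Real.zero_rpow hε.ne']
    · rw [tau_zero, ArithmeticFunction.one_apply, one_mul]
      split_ifs
      · exact Real.one_le_rpow (by exact_mod_cast hn) hε.le
      · exact Real.rpow_nonneg (Nat.cast_nonneg _) _
  | succ j ih =>
    have hε2 : 0 < ε / 2 := by linarith
    obtain ⟨C₁, hC₁, h₁⟩ := ih hε2
    obtain ⟨C₂, hC₂, h₂⟩ := Literature.NumberTheory.Sieve.exists_card_divisors_le_mul_rpow' hε2
    refine ⟨C₁ * C₂, one_le_mul_of_one_le_of_one_le hC₁ hC₂, fun n => ?_⟩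
    rcases Nat.eq_zero_or_pos n with rfl | hn
    · simp [Real.zero_rpow hε.ne']
    have hn' : (0 : ℝ) < n := by exact_mod_cast hn
    rw [tau_succ_apply]
    calc ∑ d ∈ n.divisors, tau j d
        ≤ ∑ d ∈ n.divisors, C₁ * (n : ℝ) ^ (ε / 2) := Finset.sum_le_sum fun d hd => by
            have hdn : (d : ℝ) ≤ n := by exact_mod_cast Nat.divisor_le hd
            exact (h₁ d).trans (mul_le_mul_of_nonneg_left
              (Real.rpow_le_rpow (Nat.cast_nonneg _) hdn hε2.le) (by linarith))
      _ = (n.divisors.card : ℝ) * (C₁ * (n : ℝ) ^ (ε / 2)) := by rw [Finset.sum_const, nsmul_eq_mul]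
      _ ≤ (C₂ * (n : ℝ) ^ (ε / 2)) * (C₁ * (n : ℝ) ^ (ε / 2)) :=
            mul_le_mul_of_nonneg_right (h₂ n) (by positivity)
      _ = C₁ * C₂ * ((n : ℝ) ^ (ε / 2) * (n : ℝ) ^ (ε / 2)) := by ring
      _ = C₁ * C₂ * (n : ℝ) ^ ε := by rw [← Real.rpow_add hn']; ring_nf

/-- **`Σ_n τ_j(n)/n^σ < ∞` for `σ > 1`** — absolute convergence of `ζ^k(s) = Σ d_k(n)n^{−s}` (`σ > 1`) on the real
axis (divisor bound with exponent `(σ−1)/2`, comparison with `Σ n^{ε−σ}`). [cite: Ivic1985, §1.6 (1.68), p. 30] -/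
theorem summable_tau_div_rpow (j : ℕ) {σ : ℝ} (hσ : 1 < σ) :
    Summable fun n : ℕ => tau j n / (n : ℝ) ^ σ := by
  set ε : ℝ := (σ - 1) / 2 with hε
  have hε0 : 0 < ε := by rw [hε]; linarith
  obtain ⟨C, -, hC⟩ := exists_tau_le_mul_rpow j hε0
  have hexp : ε - σ < -1 := by rw [hε]; linarith
  have hbound : ∀ n : ℕ, tau j n / (n : ℝ) ^ σ ≤ C * (n : ℝ) ^ (ε - σ) := by
    intro n
    rcases Nat.eq_zero_or_pos n with rfl | hn
    · simp [Real.zero_rpow (by linarith : (ε - σ) ≠ 0), Real.zero_rpow (by linarith : σ ≠ 0)]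
    · have hn' : (0 : ℝ) < n := by exact_mod_cast hn
      rw [div_le_iff₀ (Real.rpow_pos_of_pos hn' σ), mul_assoc, ← Real.rpow_add hn', sub_add_cancel]
      exact hC n
  refine Summable.of_nonneg_of_le
    (fun n => div_nonneg (tau_nonneg _ _) (Real.rpow_nonneg (Nat.cast_nonneg _) _)) hbound ?_
  exact (Real.summable_nat_rpow.mpr hexp).mul_left C

/-- The same in the `τ_j(n)·n^{−σ}` shape (as `Section7I1Line.summable_tau_five`). [cite: Ivic1985, §1.6 (1.68), p. 30] -/
theorem summable_tau_mul_rpow_neg (j : ℕ) {σ : ℝ} (hσ : 1 < σ) :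
    Summable fun n : ℕ => tau j n * (n : ℝ) ^ (-σ) := by
  refine (summable_tau_div_rpow j hσ).congr fun n => ?_
  rw [Real.rpow_neg (Nat.cast_nonneg _), div_eq_mul_inv]

/-- **`Σ_l τ_j(al)/l^σ < ∞` for `a ≥ 1`, `σ > 1`** (a sub-series of `Σ_n τ_j(n)/n^σ`, times `a^σ`).
[cite: Ivic1985, §1.6 (1.68), p. 30] -/
theorem summable_tau_mul_div_rpow (j : ℕ) {a : ℕ} (ha : 0 < a) {σ : ℝ} (hσ : 1 < σ) :
    Summable fun l : ℕ => tau j (a * l) / (l : ℝ) ^ σ := by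
  have h1 : Summable fun l : ℕ => tau j (a * l) / ((a * l : ℕ) : ℝ) ^ σ :=
    (summable_tau_div_rpow j hσ).comp_injective (mul_right_injective₀ ha.ne')
  have h2 : ∀ l : ℕ, tau j (a * l) / (l : ℝ) ^ σ = (a : ℝ) ^ σ * (tau j (a * l) / ((a * l : ℕ) : ℝ) ^ σ) := by
    intro l
    have ha' : (0 : ℝ) < a := by exact_mod_cast ha
    rcases Nat.eq_zero_or_pos l with rfl | hl
    · simp [Real.zero_rpow (by linarith : σ ≠ 0)]
    · have hl' : (0 : ℝ) < l := by exact_mod_cast hl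
      have hapow : (0 : ℝ) < (a : ℝ) ^ σ := Real.rpow_pos_of_pos ha' σ
      push_cast
      rw [Real.mul_rpow ha'.le hl'.le]
      field_simp
  simp_rw [h2]
  exact h1.mul_left _

/-- The bounded-shift form: `Σ_l τ_j(al)/l^σ ≤ τ_j(a)·Σ_l τ_j(l)/l^σ` for `σ > 1` (submultiplicativity `tau_mul_le`).
[cite: Ivic1985, §1.6 (1.68), p. 30] [cite: Bordelles2020ArithmeticTales, Ch. 4, Exercise 89 (a) and its solution] -/
theorem tsum_tau_mul_div_rpow_le (j a : ℕ) {σ : ℝ} (hσ : 1 < σ) :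
    ∑' l : ℕ, tau j (a * l) / (l : ℝ) ^ σ ≤ tau j a * ∑' l : ℕ, tau j l / (l : ℝ) ^ σ := by
  rw [← tsum_mul_left]
  rcases Nat.eq_zero_or_pos a with rfl | ha
  · simp
  refine Summable.tsum_le_tsum (fun l => ?_) (summable_tau_mul_div_rpow j ha hσ)
    ((summable_tau_div_rpow j hσ).mul_left _)
  rw [← mul_div_assoc]
  exact div_le_div_of_nonneg_right (tau_mul_le j a l) (Real.rpow_nonneg (Nat.cast_nonneg _) _)

/-! ### Logarithmic first moments: `Σ_{n≤Y} τ_j(n)/n ≤ (1 + log Y)^j` -/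

/-- **Dirichlet hyperbola inequality for `τ`**: `Σ_{1≤n≤Y} τ_{j₁+j₂}(n)/n ≤ (Σ_{1≤n≤Y} τ_{j₁}(n)/n)(Σ_{1≤n≤Y} τ_{j₂}(n)/n)`
(`τ_{j₁+j₂}(n)/n = Σ_{kl=n} (τ_{j₁}(k)/k)(τ_{j₂}(l)/l)` and the antidiagonals of `1 ≤ n ≤ Y` are disjoint subsets of
`[1,Y]²`) — the hyperbola-method step behind the printed `Σ_{n≤x} τ_k(n) ≪ x(log x)^{k−1}` ((1.80) with `ℓ = 1`), in
logarithmic form with constant `1`. [cite: IwaniecKowalski2004, §1.6 (1.80)] -/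
theorem sum_tau_add_div_Icc_le (j₁ j₂ Y : ℕ) :
    ∑ n ∈ Icc 1 Y, tau (j₁ + j₂) n / n ≤
      (∑ n ∈ Icc 1 Y, tau j₁ n / n) * (∑ n ∈ Icc 1 Y, tau j₂ n / n) := by
  classical
  have h1 : ∀ n ∈ Icc 1 Y, tau (j₁ + j₂) n / n =
      ∑ p ∈ n.divisorsAntidiagonal, tau j₁ p.1 / p.1 * (tau j₂ p.2 / p.2) := by
    intro n _
    rw [tau_add_apply, Finset.sum_div]
    refine Finset.sum_congr rfl fun p hp => ?_
    have hn : (p.1 : ℝ) * p.2 = n := by exact_mod_cast (Nat.mem_divisorsAntidiagonal.mp hp).1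
    rw [div_mul_div_comm, hn]
  rw [Finset.sum_congr rfl h1, ← Finset.sum_biUnion]
  · rw [Finset.sum_mul_sum, ← Finset.sum_product']
    refine Finset.sum_le_sum_of_subset_of_nonneg ?_ fun p _ _ =>
      mul_nonneg (div_nonneg (tau_nonneg _ _) (Nat.cast_nonneg _))
        (div_nonneg (tau_nonneg _ _) (Nat.cast_nonneg _))
    intro p hp
    obtain ⟨n, hn, hpn⟩ := Finset.mem_biUnion.mp hp
    have hp12 : p.1 * p.2 = n := (Nat.mem_divisorsAntidiagonal.mp hpn).1
    have hn0 : n ≠ 0 := (Nat.mem_divisorsAntidiagonal.mp hpn).2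
    have hnY : n ≤ Y := (Finset.mem_Icc.mp hn).2
    have hp1 : 0 < p.1 := Nat.pos_of_ne_zero fun h => hn0 (by rw [← hp12, h, zero_mul])
    have hp2 : 0 < p.2 := Nat.pos_of_ne_zero fun h => hn0 (by rw [← hp12, h, mul_zero])
    refine Finset.mem_product.mpr ⟨Finset.mem_Icc.mpr ⟨hp1, ?_⟩, Finset.mem_Icc.mpr ⟨hp2, ?_⟩⟩
    · calc p.1 ≤ p.1 * p.2 := Nat.le_mul_of_pos_right _ hp2
        _ ≤ Y := hp12 ▸ hnY
    · calc p.2 ≤ p.1 * p.2 := Nat.le_mul_of_pos_left _ hp1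
        _ ≤ Y := hp12 ▸ hnY
  · intro n _ n' _ hne
    rw [Function.onFun, Finset.disjoint_left]
    intro p hp hp'
    exact hne ((Nat.mem_divisorsAntidiagonal.mp hp).1.symm.trans (Nat.mem_divisorsAntidiagonal.mp hp').1)

/-- `Σ_{1≤n≤Y} τ₀(n)/n ≤ 1` (`τ₀ = δ₁`: only `n = 1` contributes; base case of the induction for (1.80)'s logarithmic
form). [cite: IwaniecKowalski2004, §1.6 (1.80)] -/
theorem sum_tau_zero_div_Icc_le_one (Y : ℕ) : ∑ n ∈ Icc 1 Y, tau 0 n / n ≤ 1 := by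
  rcases Nat.eq_zero_or_pos Y with rfl | hY
  · simp
  have h1 : (1 : ℕ) ∈ Icc 1 Y := Finset.mem_Icc.mpr ⟨le_rfl, hY⟩
  rw [← Finset.add_sum_erase _ _ h1, tau_zero, ArithmeticFunction.one_apply, if_pos rfl, Nat.cast_one, div_one]
  have h0 : ∑ x ∈ (Icc 1 Y).erase 1, (1 : ArithmeticFunction ℝ) x / (x : ℝ) = 0 := by
    refine Finset.sum_eq_zero fun x hx => ?_
    rw [ArithmeticFunction.one_apply, if_neg (Finset.ne_of_mem_erase hx), zero_div]
  rw [h0, add_zero]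

/-- `Σ_{1≤n≤Y} τ₁(n)/n = Σ_{1≤n≤Y} 1/n ≤ 1 + log Y` (Mathlib's `harmonic_le_one_add_log`; the `k = 1` case).
[cite: IwaniecKowalski2004, §1.6 (1.80)] -/
theorem sum_tau_one_div_Icc_le (Y : ℕ) : ∑ n ∈ Icc 1 Y, tau 1 n / n ≤ 1 + Real.log Y := by
  have h := harmonic_le_one_add_log Y
  rw [harmonic_eq_sum_Icc] at h
  push_cast at h
  refine le_trans (le_of_eq (Finset.sum_congr rfl fun n hn => ?_)) h
  rw [tau_one_apply (by have := (Finset.mem_Icc.mp hn).1; omega), one_div]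

/-- **`Σ_{1≤n≤Y} τ_j(n)/n ≤ (1 + log Y)^j`** for every `j` and `Y` (induction on `j` with `sum_tau_add_div_Icc_le`;
for `Y = 0` the left side is `0`) — the logarithmic form, with explicit constant `1`, of the printed
`Σ_{n≤x} τ_k(n) ≪ x(log x)^{k−1}` ((1.80), `ℓ = 1`); Zhang 2022 quotes such counts as "`Σ τ_k(m)/m ≪ 𝓛^c`".
[cite: IwaniecKowalski2004, §1.6 (1.80)] -/
theorem sum_tau_div_Icc_le_log_pow (j Y : ℕ) : ∑ n ∈ Icc 1 Y, tau j n / n ≤ (1 + Real.log Y) ^ j := by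
  have hlog : 0 ≤ 1 + Real.log Y := by
    have := Real.log_natCast_nonneg Y
    linarith
  induction j with
  | zero => rw [pow_zero]; exact sum_tau_zero_div_Icc_le_one Y
  | succ j ih =>
    calc ∑ n ∈ Icc 1 Y, tau (j + 1) n / n
        ≤ (∑ n ∈ Icc 1 Y, tau j n / n) * (∑ n ∈ Icc 1 Y, tau 1 n / n) := sum_tau_add_div_Icc_le j 1 Y
      _ ≤ (1 + Real.log Y) ^ j * (1 + Real.log Y) :=
          mul_le_mul ih (sum_tau_one_div_Icc_le Y)
            (Finset.sum_nonneg fun n _ => div_nonneg (tau_nonneg _ _) (Nat.cast_nonneg _))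
            (pow_nonneg hlog j)
      _ = (1 + Real.log Y) ^ (j + 1) := by rw [pow_succ]

/-- Real-cutoff form: for `x ≥ 1`, `Σ_{1≤n≤x} τ_j(n)/n ≤ (1 + log x)^j`. [cite: IwaniecKowalski2004, §1.6 (1.80)] -/
theorem sum_tau_div_Icc_floor_le_log_pow (j : ℕ) {x : ℝ} (hx : 1 ≤ x) :
    ∑ n ∈ Icc 1 ⌊x⌋₊, tau j n / n ≤ (1 + Real.log x) ^ j := by
  refine (sum_tau_div_Icc_le_log_pow j ⌊x⌋₊).trans (pow_le_pow_left₀ ?_ ?_ j)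
  · have := Real.log_natCast_nonneg ⌊x⌋₊
    linarith
  · have h1 : (1 : ℝ) ≤ ⌊x⌋₊ := by exact_mod_cast Nat.one_le_iff_ne_zero.mpr (Nat.floor_pos.mpr hx).ne'
    have h2 : (⌊x⌋₊ : ℝ) ≤ x := Nat.floor_le (by linarith)
    linarith [Real.log_le_log (by linarith) h2]

/-- Shifted form: `Σ_{1≤n≤Y} τ_j(an)/n ≤ τ_j(a)(1 + log Y)^j` (submultiplicativity `tau_mul_le`).
[cite: IwaniecKowalski2004, §1.6 (1.80)] -/
theorem sum_tau_mul_div_Icc_le (j a Y : ℕ) :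
    ∑ n ∈ Icc 1 Y, tau j (a * n) / n ≤ tau j a * (1 + Real.log Y) ^ j := by
  calc ∑ n ∈ Icc 1 Y, tau j (a * n) / n ≤ ∑ n ∈ Icc 1 Y, tau j a * (tau j n / n) :=
        Finset.sum_le_sum fun n _ => by
          rw [← mul_div_assoc]
          exact div_le_div_of_nonneg_right (tau_mul_le j a n) (Nat.cast_nonneg _)
    _ = tau j a * ∑ n ∈ Icc 1 Y, tau j n / n := by rw [Finset.mul_sum]
    _ ≤ tau j a * (1 + Real.log Y) ^ j :=
        mul_le_mul_of_nonneg_left (sum_tau_div_Icc_le_log_pow j Y) (tau_nonneg _ _)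

/-- First moments are dominated by the tree's second-moment count: for `j ≥ 1`,
`Σ_{1≤n≤Y} τ_j(n)/n ≤ Σ_{1≤n≤Y} τ_j(n)²/n`. [cite: IwaniecKowalski2004, §1.6 (1.80)] -/
theorem sum_tau_div_Icc_le_sum_sq_div {j : ℕ} (hj : 1 ≤ j) (Y : ℕ) :
    ∑ n ∈ Icc 1 Y, tau j n / n ≤ ∑ n ∈ Icc 1 Y, tau j n ^ 2 / n :=
  Finset.sum_le_sum fun n hn =>
    div_le_div_of_nonneg_right (tau_le_tau_sq hj (by have := (Finset.mem_Icc.mp hn).1; omega))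
      (Nat.cast_nonneg _)

end Literature.NumberTheory.LFunctions.Zhang2022.MeanSquareMajorant
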